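import Literature.AlgebraicGeometry.RelativeSpec.SubringSpec
import Mathlib.AlgebraicGeometry.Morphisms.Separated
import Mathlib.AlgebraicGeometry.IdealSheaf.Basic
import HarnessLib

/-!
# The relative spectrum of a quasi-coherent subalgebra of `f_* 𝒪_X`, II: morphisms into it

Continuation of `Literature.AlgebraicGeometry.RelativeSpec.SubringSpec`. For a subring datum `D`
for a qcqs morphism `f : X ⟶ Y` (subrings `D.ring U ⊆ Γ(X, f⁻¹U)` forming a quasi-coherent
`𝒪_Y`-subalgebra of `f_* 𝒪_X`) with relative spectrum `D.spec = Spec_Y(D.ring) → Y`, we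
construct morphisms **into** `D.spec`:

* `SubringDatum.lift t φ : T ⟶ D.spec` for a morphism `t : T ⟶ Y` and a map of presheaves of
  rings `φ : D.ring ⟶ t_* 𝒪_T`, glued from `t⁻¹U → Spec Γ(T, t⁻¹U) → Spec (D.ring U)` over the
  affine opens `U` (Stacks 01LQ: `Hom_Y(T, Spec_Y 𝒜) = Hom_{𝒪_Y-alg}(𝒜, t_* 𝒪_T)`; we only need
  and only construct the map from right to left), with `ι_lift`, `lift_fromSpec`
  (`lift ≫ fromSpec = t` when `φ` is a map under `𝒪_Y`), the computation on sections over affines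
  `lift_app_preimage`, `objIso_hom_comp`, and affineness / quasi-compactness of the lift;
* the canonical `SubringDatum.toSpec : X ⟶ D.spec` (the case `T = X`, `φ` the inclusions), with
  `toSpec_fromSpec : toSpec ≫ fromSpec = f`, `toSpec_app_preimage`, `ker_toSpec = ⊥`, dominance,
  and `D.spec` reduced / integral when `X` is.

For the datum of invariants of a finite group `G` acting on `X` over `Y`, `toSpec` is the
quotient map `X → X/G` and `lift` produces the maps into `X/G` (Mumford, *Abelian Varieties*, §7,
Thm. p. 66; §12). All proofs follow Mathlib's `Mathlib.AlgebraicGeometry.Normalization`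
(`toNormalization`, `ι_toNormalization`, `toNormalization_fromNormalization`,
`toNormalization_app_preimage`, `normalizationObjIso_hom_val`, `ker_toNormalization`, Stacks 0AXN)
with the inclusion of the integral closure replaced by `φ`.

## References

* Mathlib, `Mathlib/AlgebraicGeometry/Normalization.lean` (A. Yang, 2025).
* [StacksProject, Tag 01LQ]. [MumfordAV1970] §7 (Thm. p. 66), §12.
-/

noncomputable section

universe u

open CategoryTheory Limits AlgebraicGeometry

namespace Literature.AlgebraicGeometry.RelativeSpec

namespace SubringDatum

open Scheme.AffineZariskiSite

variable {X Y : Scheme.{u}} {f : X ⟶ Y} (D : SubringDatum f) [QuasiCompact f] [QuasiSeparated f]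

/-- Restriction along `W = V` followed by restriction along `V ≤ W` is the identity on
`Γ(T, V)` (both maps come from the thin category of opens). [folklore] -/
theorem _root_.Literature.AlgebraicGeometry.RelativeSpec.presheaf_map_eqToHom_op_comp_map_homOfLE_op
    {T : Scheme.{u}} {V W : T.Opens} (e : W = V) (h : V ≤ W) :
    T.presheaf.map (eqToHom e).op ≫ T.presheaf.map (homOfLE h).op = 𝟙 _ := by
  subst e
  rw [← T.presheaf.map_comp, ← T.presheaf.map_id]
  exact congrArg T.presheaf.map (Subsingleton.elim _ _)

/-! ### Morphisms into the relative spectrum -/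

section Lift

variable {T : Scheme.{u}} (t : T ⟶ Y)
  (φ : D.diagram ⟶ (TopologicalSpace.Opens.map t.base).op ⋙ T.presheaf)
  (hφ : ∀ U : Y.Opens, D.diagramMap.app (.op U) ≫ φ.app (.op U) = t.app U)

set_option backward.defeqAttrib.useBackward true in
set_option backward.isDefEq.respectTransparency false in
/-- **Morphisms into `Spec_Y(D.ring)`.** A morphism `t : T ⟶ Y` together with a map of
presheaves of rings `φ : D.ring ⟶ t_* 𝒪_T` gives `T ⟶ Spec_Y(D.ring)`: glue the
`t⁻¹U → Spec Γ(T, t⁻¹U) → Spec (D.ring U)` over the affine opens `U` (cf. Mathlib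
`toNormalization`, the case `T = X`, `φ` the inclusion). It lies over `t` when `φ` is a map under
`𝒪_Y` (`lift_fromSpec`). (Stacks 01LQ: `Hom_Y(T, Spec_Y 𝒜) = Hom_{𝒪_Y-alg}(𝒜, t_* 𝒪_T)`.)
[folklore] -/
def lift : T ⟶ D.spec :=
  Scheme.OpenCover.glueMorphismsOfLocallyDirected ((directedCover Y).pullback₁ t)
    (fun U ↦ (pullbackRestrictIsoRestrict t _).hom ≫ (t ⁻¹ᵁ U.1).toSpecΓ ≫
      Spec.map (φ.app (.op U.1)) ≫ D.openCover.f U) fun {U V : Y.AffineZariskiSite} i ↦ by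
  have : (pullbackRestrictIsoRestrict t U.1).inv ≫
      Scheme.Cover.trans ((directedCover Y).pullback₁ t) i ≫
      (pullbackRestrictIsoRestrict t V.1).hom = T.homOfLE
        (t.preimage_mono (toOpens_mono i.1.1)) := by
    rw [← cancel_mono (Scheme.Opens.ι _)]
    simp +instances [Scheme.Cover.trans, Scheme.Cover.locallyDirectedPullbackCover]
  rw [← Iso.inv_comp_eq, reassoc_of% this, ← Scheme.Opens.toSpecΓ_SpecMap_presheaf_map_assoc,
    ← Spec.map_comp_assoc]
  dsimp [openCover]
  rw [← colimit.w D.glueData.functor i]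
  dsimp [glueData, relativeGluingData]
  rw [← Spec.map_comp_assoc]
  congr 2
  exact congrArg Spec.map (φ.naturality ((toOpensFunctor Y).map i).op).symm

set_option backward.defeqAttrib.useBackward true in
/-- The lift on the open `t⁻¹U`, `U` affine: `t⁻¹U → Spec Γ(T, t⁻¹U) → Spec (D.ring U) ↪ Spec_Y`.
(cf. Mathlib `ι_toNormalization`.) [folklore] -/
@[reassoc]
theorem ι_lift (U : Y.affineOpens) :
    (t ⁻¹ᵁ U.1).ι ≫ D.lift t φ = (t ⁻¹ᵁ U.1).toSpecΓ ≫
      Spec.map (φ.app (.op U.1)) ≫ D.openCover.f U := by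
  rw [← cancel_epi (pullbackRestrictIsoRestrict t U.1).hom, ← Category.assoc]
  trans ((directedCover Y).pullback₁ t).f U ≫ D.lift t φ
  · congr 1; simp
  delta lift
  generalize_proofs _ _ _ _ H
  exact Scheme.OpenCover.map_glueMorphismsOfLocallyDirected _ _ H _

set_option backward.isDefEq.respectTransparency false in
include hφ in
/-- The lift lies over `t`: `lift ≫ fromSpec = t`, when `φ` is a map of `𝒪_Y`-algebras
(cf. Mathlib `toNormalization_fromNormalization`). [folklore] -/
@[reassoc]
theorem lift_fromSpec : D.lift t φ ≫ D.fromSpec = t := by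
  refine Scheme.Cover.hom_ext (T.openCoverOfIsOpenCover _
    (.comap (iSup_affineOpens_eq_top Y) t.base.1)) _ _ fun U ↦ ?_
  refine (D.ι_lift_assoc t φ _ _).trans ?_
  rw [D.ι_fromSpec, ← Spec.map_comp_assoc, hφ]
  change (t ⁻¹ᵁ U.1).toSpecΓ ≫ Spec.map (t.app _) ≫ U.2.fromSpec = (t ⁻¹ᵁ U.1).ι ≫ _
  simp

set_option backward.isDefEq.respectTransparency false in
include hφ in
/-- **The lift on sections over an affine `U`**: `Γ(Spec_Y, fromSpec⁻¹U) ≅ D.ring U →φ Γ(T, t⁻¹U)`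
(cf. Mathlib `toNormalization_app_preimage`). [folklore] -/
theorem lift_app_preimage (U : Y.affineOpens) :
    (D.lift t φ).app (D.fromSpec ⁻¹ᵁ ↑U) =
      (D.objIso U.2).hom ≫ φ.app (.op U.1) ≫
      T.presheaf.map (eqToHom (by simp [← Scheme.Hom.comp_preimage, D.lift_fromSpec t φ hφ])).op := by
  dsimp [objIso]
  change _ = D.spec.presheaf.map (eqToHom (by simp [fromSpec_preimage])).op ≫
      ((D.openCover.f U).appIso _).hom ≫
      (Scheme.ΓSpecIso _).hom ≫ φ.app (.op U.1) ≫
      T.presheaf.map (eqToHom (by simp [← Scheme.Hom.comp_preimage, D.lift_fromSpec t φ hφ])).op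
  have H : D.lift t φ ⁻¹ᵁ D.fromSpec ⁻¹ᵁ U =
      (t ⁻¹ᵁ U).ι ''ᵁ (((t ⁻¹ᵁ U).ι ≫ D.lift t φ) ⁻¹ᵁ D.fromSpec ⁻¹ᵁ U) := by
    simp [← Scheme.Hom.comp_preimage, D.lift_fromSpec t φ hφ]
  convert! congr($(Scheme.Hom.congr_app (D.ι_lift t φ U) (D.fromSpec ⁻¹ᵁ U)) ≫
    T.presheaf.map (eqToHom H).op) using 1
  · simp [Scheme.Hom.app_eq_appLE]
  dsimp
  simp only [eqToHom_op, Scheme.Hom.appIso_hom, Category.assoc, Scheme.Hom.naturality_assoc,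
    eqToHom_unop, ← Functor.map_comp_assoc, eqToHom_map (TopologicalSpace.Opens.map _),
    eqToHom_trans]
  congr 1
  rw [← IsIso.eq_inv_comp, ← Functor.map_inv, inv_eqToHom]
  simp [← Functor.map_comp, Scheme.Opens.toSpecΓ_appTop,
    Scheme.ΓSpecIso_naturality_assoc (φ.app (.op U.1))]
  rfl

set_option backward.isDefEq.respectTransparency false in
include hφ in
/-- `objIso` identifies `φ` with the restriction map of the lift (cf. Mathlib
`normalizationObjIso_hom_val`). [folklore] -/
theorem objIso_hom_comp (U : Y.affineOpens) :
    (D.objIso U.2).hom ≫ φ.app (.op U.1) =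
      (D.lift t φ).appLE _ _ (by simp [← Scheme.Hom.comp_preimage, D.lift_fromSpec t φ hφ]) := by
  rw [Scheme.Hom.appLE, D.lift_app_preimage t φ hφ U, Category.assoc, Category.assoc]
  congr 1
  exact (Category.comp_id _).symm.trans
    (congrArg (φ.app _ ≫ ·) (presheaf_map_eqToHom_op_comp_map_homOfLE_op _ _).symm)

include hφ in
/-- If `t` is affine, so is the lift (cf. Mathlib). [folklore] -/
theorem isAffineHom_lift [IsAffineHom t] : IsAffineHom (D.lift t φ) := by
  apply MorphismProperty.of_postcomp (W := @IsAffineHom) (W' := @IsSeparated) _ D.fromSpec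
  · infer_instance
  · rw [D.lift_fromSpec t φ hφ]
    infer_instance

include hφ in
/-- The lift of a quasi-compact `t` is quasi-compact. [folklore] -/
theorem quasiCompact_lift [QuasiCompact t] : QuasiCompact (D.lift t φ) := by
  apply MorphismProperty.of_postcomp (W := @QuasiCompact) (W' := @QuasiSeparated) _ D.fromSpec
  · infer_instance
  · rw [D.lift_fromSpec t φ hφ]
    infer_instance

end Lift

/-! ### The canonical morphism `X ⟶ Spec_Y(D.ring)` -/

/-- The inclusions `D.ring U ⊆ Γ(X, f⁻¹U)` as a map of presheaves `D.ring ⟶ f_* 𝒪_X`.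
[folklore] -/
def inclusion : D.diagram ⟶ (TopologicalSpace.Opens.map f.base).op ⋙ X.presheaf where
  app U := CommRingCat.ofHom (D.ring U.unop).subtype
  naturality _ _ _ := rfl

omit [QuasiCompact f] [QuasiSeparated f] in
/-- The inclusion is a map under `𝒪_Y`. [folklore] -/
theorem diagramMap_inclusion (U : Y.Opens) :
    D.diagramMap.app (.op U) ≫ D.inclusion.app (.op U) = f.app U :=
  rfl

/-- **The canonical morphism `X ⟶ Spec_Y(D.ring)`** over `Y`, induced by the inclusions
`D.ring U ⊆ Γ(X, f⁻¹U)` (cf. Mathlib `toNormalization`); for the invariants of a finite group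
this is the quotient map `X → X/G`. [folklore] -/
def toSpec : X ⟶ D.spec := D.lift f D.inclusion

/-- `toSpec ≫ fromSpec = f`. [folklore] -/
@[reassoc (attr := simp)]
theorem toSpec_fromSpec : D.toSpec ≫ D.fromSpec = f :=
  D.lift_fromSpec f D.inclusion D.diagramMap_inclusion

/-- `toSpec` on sections over an affine `U` is the inclusion `D.ring U ⊆ Γ(X, f⁻¹U)` (up to
`objIso`). [folklore] -/
theorem toSpec_app_preimage (U : Y.affineOpens) :
    D.toSpec.app (D.fromSpec ⁻¹ᵁ ↑U) =
      (D.objIso U.2).hom ≫ CommRingCat.ofHom (D.ring U.1).subtype ≫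
      X.presheaf.map (eqToHom (by simp [← Scheme.Hom.comp_preimage])).op :=
  D.lift_app_preimage f D.inclusion D.diagramMap_inclusion U

/-- `toSpec` is affine when `f` is. [folklore] -/
instance isAffineHom_toSpec [IsAffineHom f] : IsAffineHom D.toSpec :=
  D.isAffineHom_lift f D.inclusion D.diagramMap_inclusion

/-- `toSpec` is quasi-compact. [folklore] -/
instance quasiCompact_toSpec : QuasiCompact D.toSpec :=
  D.quasiCompact_lift f D.inclusion D.diagramMap_inclusion

/-- `toSpec` is schematically dominant: its kernel ideal sheaf vanishes, since each
`D.ring U → Γ(X, f⁻¹U)` is injective (cf. Mathlib `ker_toNormalization`). [folklore] -/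
@[simp]
theorem ker_toSpec : D.toSpec.ker = ⊥ := by
  refine Scheme.IdealSheafData.ext_of_iSup_eq_top
    (fun U : Y.affineOpens ↦ ⟨D.fromSpec ⁻¹ᵁ U.1, U.2.preimage _⟩)
    (TopologicalSpace.IsOpenCover.comap (iSup_affineOpens_eq_top _) _) fun U ↦ ?_
  simp only [Scheme.Hom.ker_apply, Scheme.IdealSheafData.ideal_bot, Pi.bot_apply]
  rw [← RingHom.injective_iff_ker_eq_bot,
    ← ConcreteCategory.mono_iff_injective_of_preservesPullback, ← MorphismProperty.monomorphisms]
  simp only [toSpec_app_preimage,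
    eqToHom_op, MorphismProperty.cancel_left_of_respectsIso,
    MorphismProperty.cancel_right_of_respectsIso]
  rw [MorphismProperty.monomorphisms, @ConcreteCategory.mono_iff_injective_of_preservesPullback]
  exact Subtype.val_injective

/-- `toSpec : X ⟶ Spec_Y(D.ring)` is dominant. [folklore] -/
instance isDominant_toSpec : IsDominant D.toSpec := by
  have := congr(($(D.ker_toSpec).support : Set D.spec))
  rw [Scheme.IdealSheafData.support_bot, Scheme.Hom.support_ker,
    TopologicalSpace.Closeds.coe_top] at this
  exact ⟨dense_iff_closure_eq.mpr this⟩

set_option backward.defeqAttrib.useBackward true in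
/-- `Spec_Y(D.ring)` is reduced if `X` is (the `D.ring U` are subrings of reduced rings; cf.
Mathlib, Stacks 0AXN for normalization). [folklore] -/
instance isReduced_spec [AlgebraicGeometry.IsReduced X] : AlgebraicGeometry.IsReduced D.spec :=
  have (i : _) : AlgebraicGeometry.IsReduced (D.openCover.X i) := by
    have : _root_.IsReduced (D.diagram.obj (.op i.1)) :=
      isReduced_of_injective (D.ring i.1).subtype Subtype.val_injective
    dsimp [openCover, glueData, relativeGluingData]
    infer_instance
  .of_openCover _ D.openCover

/-- `Spec_Y(D.ring)` is integral if `X` is (reduced, and irreducible as the closure of the image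
of the dominant `toSpec`). [folklore] -/
instance isIntegral_spec [AlgebraicGeometry.IsIntegral X] : AlgebraicGeometry.IsIntegral D.spec :=
  have : IrreducibleSpace D.spec := by
    rw [irreducibleSpace_def]
    convert!
      ((IrreducibleSpace.isIrreducible_univ X).image _
          D.toSpec.continuous.continuousOn).closure
    simpa using D.toSpec.denseRange.closure_range.symm
  isIntegral_of_irreducibleSpace_of_isReduced _

end SubringDatum

end Literature.AlgebraicGeometry.RelativeSpec
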